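import Literature.NumberTheory.GaloisRepresentations.InertiaCohomologyTorsionBound
import Literature.NumberTheory.GaloisRepresentations.ContinuousH1TrivialAction
import Literature.NumberTheory.GaloisRepresentations.PPrimaryDevissage
import HarnessLib

/-!
# `H¹(I_v, A) ↪ H¹(I_v, A/C)` for a Tate-shaped inertia module at `v ∤ p` (abstract local form of
# the vanishing of `H¹(I_v, C) → H¹(I_v, E[p^∞])` at a multiplicative place)

HONEST FRAMING (cell `b2b-bsdres`, run/shared/lean/b2b/bsd-rank1-residual/, verbatim in every
file): the goal of the cell is to DELETE the COMBINATION-SHAPED residual classes of the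
Birch–Swinnerton-Dyer formula for ALL analytic-rank `≤ 1` elliptic curves over `ℚ` — "full BSD
formula for every rank `≤ 1` curve in class `C`" assembled STRICTLY from published theorems — so
that the rank-`≤ 1` remainder becomes exactly the CONSTRUCTION-SHAPED classes, which are TYPED
(missing-input `Prop`s), NOT attempted. This is not "finishing BSD". Sub-cell
`b2b-bsdres-eisenstein-p2` (CLASS-OWNERS row "X2"), gen 29, programme P1 (the UPPER HALF of
Greenberg–Vatsal Cor. (2.3)/Prop. (2.4) in the kernel, X2-GAP §34): research route; NO CLAIM BEYOND
STATED CLASSES; nothing here changes a label. Theorems only; axioms standard; no `sorry`.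

ABSTRACT LOCAL SETTING (instantiated at a multiplicative place `v ∤ p` by the Tate datum
`C = Φ(μ_{p^∞}) ⊂ A = E[p^∞]`, `D = A/C`, in the sequel file): `F` a non-archimedean local field with
inertia group `I = absInertia F`, `ρ` a continuous representation of `Γ_F` on a DISCRETE `p`-primary,
`p`-divisible `ℤ`-module `A` (`p ≠` residue characteristic), `C ≤ A` a `Γ_F`-stable `p`-divisible
submodule with `#C[p] ≤ p`, such that `I` acts TRIVIALLY on `C` and on `D = A/C` but NOT on `A`.

* §1 `eq_top_of_divisible_of_card_nsmul_le` — a nonzero `p`-divisible subgroup of a `p`-primary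
  group `Y` with `#Y[p] ≤ p` is all of `Y`; `exists_prime_pow_smul_oneCocycleClass_eq_zero` —
  `H¹(G, X)` is `p`-primary for compact `G` and discrete `p`-primary `X`.
* §2 **`cohomologyMap_mkQHom_one_injective`: `H¹(I, A) → H¹(I, D)` is INJECTIVE**, i.e.
  `H¹(I, C) → H¹(I, A)` vanishes: the connecting map `δ₀ : D^I = D → H¹(I, C)` has divisible,
  nonzero image (nonzero because `A^I ≠ A`), inside the `p`-primary group `H¹(I, C)` whose
  `p`-torsion has order `≤ #C[p] ≤ p` (`natCard_torsionBy_continuousCohomology_one_absInertia_le`),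
  hence is everything (§1). (For the Tate curve: every tame character `I_v → μ_{p^n}` is the Kummer
  character of a root of a power of `q`, GV p. 14 "`0 → C → A → D → 0`", Silverman V.5.3.)
The two consequences GV's Prop. (2.4) needs (`#H¹(I, A)[p] ≤ #D[p]`; vanishing of `p`-torsion classes
invariant under the prime-to-`p` part of a Frobenius when `p ∤ q_F − a`) are in the sequel
`LocalInertiaTateQuotientBounds`.

References: Greenberg–Vatsal, Invent. Math. 142 (2000) §2 pp. 14–15, Prop. (2.4) p. 22;
R. Greenberg, Adv. Stud. Pure Math. 17 (1989) §2 Prop. 2; Serre, *Galois Cohomology* I §2.2;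
Silverman *ATAEC* V.5.3.
-/

set_option autoImplicit false

noncomputable section

open scoped Classical

open CategoryTheory Function Filter Field ValuativeRel
open Literature.NumberTheory.GaloisRepresentations
  Literature.NumberTheory.GaloisRepresentations.IsNonarchimedeanLocalField

universe u

namespace Summit.BirchSwinnertonDyer.Rank1Residual.X2.LocalInertiaTateQuotient

/-! ## §1. Two generic lemmas -/

/-- **A nonzero `p`-divisible subgroup of a `p`-primary abelian group `Y` with `#Y[p] ≤ p` is all of
`Y`.** (`M` contains an element of order `p`, so `M[p] = Y[p]`; then induction on the exponent using
divisibility.) [folklore] -/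
theorem eq_top_of_divisible_of_card_nsmul_le {Y : Type*} [AddCommGroup Y] {p : ℕ} [hp : Fact p.Prime]
    (hY : ∀ y : Y, ∃ n : ℕ, p ^ n • y = 0)
    (hcard : ∀ s : Finset Y, (∀ y ∈ s, p • y = 0) → s.card ≤ p)
    (M : AddSubgroup Y) (hdiv : ∀ m ∈ M, ∃ m' ∈ M, p • m' = m) (hne : M ≠ ⊥) : M = ⊤ := by
  classical
  -- an element of order `p` in `M`
  obtain ⟨m₀, hm₀M, hm₀⟩ : ∃ m₀ ∈ M, m₀ ≠ 0 := by
    by_contra h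
    push Not at h
    exact hne ((AddSubgroup.eq_bot_iff_forall _).2 h)
  have hex : ∃ k : ℕ, p ^ k • m₀ = 0 := hY m₀
  have hk₀ : p ^ Nat.find hex • m₀ = 0 := Nat.find_spec hex
  have hk₀pos : 0 < Nat.find hex := by
    rcases Nat.eq_zero_or_pos (Nat.find hex) with h | h
    · rw [h, pow_zero, one_nsmul] at hk₀; exact absurd hk₀ hm₀
    · exact h
  set y₀ : Y := p ^ (Nat.find hex - 1) • m₀ with hy₀
  have hy₀M : y₀ ∈ M := M.nsmul_mem hm₀M _
  have hy₀ne : y₀ ≠ 0 := fun h => Nat.find_min hex (Nat.sub_lt hk₀pos one_pos) h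
  have hpy₀ : p • y₀ = 0 := by
    rw [hy₀, ← mul_nsmul', ← pow_succ', Nat.sub_add_cancel hk₀pos, hk₀]
  have hord : addOrderOf y₀ = p := addOrderOf_eq_prime hpy₀ hy₀ne
  -- every `p`-torsion element of `Y` is a multiple of `y₀`, hence lies in `M`
  have hmult : ∀ y : Y, p • y = 0 → y ∈ M := by
    intro y hy
    by_contra hyM
    let t : Finset Y := (Finset.range p).image (fun i : ℕ => i • y₀)
    have hinj : Set.InjOn (fun i : ℕ => i • y₀) (Finset.range p : Set ℕ) := by
      intro i hi j hj hij
      rw [Finset.coe_range, Set.mem_Iio, ← hord] at hi hj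
      exact nsmul_injOn_Iio_addOrderOf hi hj hij
    have ht : t.card = p := by
      rw [Finset.card_image_of_injOn hinj, Finset.card_range]
    have hy_notin : y ∉ t := by
      intro h
      obtain ⟨i, -, rfl⟩ := Finset.mem_image.1 h
      exact hyM (M.nsmul_mem hy₀M i)
    have hs : (insert y t).card = p + 1 := by rw [Finset.card_insert_of_notMem hy_notin, ht]
    have hkill : ∀ z ∈ insert y t, p • z = 0 := by
      intro z hz
      rcases Finset.mem_insert.1 hz with rfl | hz
      · exact hy
      · obtain ⟨i, -, rfl⟩ := Finset.mem_image.1 hz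
        rw [← mul_nsmul', mul_comm, mul_nsmul', hpy₀, nsmul_zero]
    have := hcard _ hkill
    omega
  -- induction on the exponent, using divisibility of `M`
  have hall : ∀ (k : ℕ) (y : Y), p ^ k • y = 0 → y ∈ M := by
    intro k
    induction k with
    | zero =>
      intro y hy
      rw [pow_zero, one_nsmul] at hy
      rw [hy]
      exact M.zero_mem
    | succ k ih =>
      intro y hy
      have hpy : p • y ∈ M := ih _ (by rw [← mul_nsmul', ← pow_succ, hy])
      obtain ⟨m', hm'M, hm'⟩ := hdiv _ hpy
      have h := hmult (y - m') (by rw [nsmul_sub, hm', sub_self])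
      have : y = (y - m') + m' := by abel
      rw [this]
      exact M.add_mem h hm'M
  rw [eq_top_iff]
  intro y _
  obtain ⟨n, hn⟩ := hY y
  exact hall n y hn

/-- **`H¹(G, X)` is `p`-primary** for a compact group `G` and a discrete `p`-primary `G`-module `X`:
a continuous cocycle has finite image, so a common power of `p` kills it. [folklore] -/
theorem exists_prime_pow_smul_oneCocycleClass_eq_zero {G : Type u} [Group G] [TopologicalSpace G]
    [IsTopologicalGroup G] [CompactSpace G] (X : TopRep.{u} ℤ G) [DiscreteTopology X] {p : ℕ}
    (hX : ∀ m : X, ∃ n : ℕ, p ^ n • m = 0) (x : continuousCohomology 1 X) :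
    ∃ N : ℕ, x ∈ Submodule.torsionBy ℤ (continuousCohomology 1 X) ((p ^ N : ℕ) : ℤ) := by
  obtain ⟨φ, rfl⟩ := oneCocycleClass_surjective _ x
  have hfinim : (Set.range (φ.1 : G → X)).Finite := (isCompact_range φ.1.continuous).finite_of_discrete
  choose k hk using hX
  obtain ⟨N, hN⟩ := (hfinim.image k).bddAbove
  -- evaluation at `g` is additive on cocycles
  have hev : ∀ (g : G) (n : ℕ) (ψ : contOneCocycles X), (n • ψ).1 g = n • ψ.1 g := by
    intro g n ψ
    induction n with
    | zero => rw [zero_nsmul, zero_nsmul]; rfl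
    | succ n ih => rw [succ_nsmul, succ_nsmul, ← ih]; rfl
  refine ⟨N, ?_⟩
  rw [Submodule.mem_torsionBy_iff, Nat.cast_smul_eq_nsmul, ← oneCocycleClassₗ_apply, ← map_nsmul,
    oneCocycleClassₗ_apply, oneCocycleClass_eq_zero_iff]
  refine ⟨0, fun g => ?_⟩
  rw [map_zero, sub_zero, hev]
  have hle : k (φ.1 g) ≤ N := hN (Set.mem_image_of_mem k ⟨g, rfl⟩)
  rw [← Nat.sub_add_cancel hle, pow_add, mul_nsmul', hk, nsmul_zero]

/-! ## §2. The abstract Tate-shaped inertia module: `H¹(I, A) ↪ H¹(I, A/C)` -/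

section Abstract

variable (F : Type u) [Field F] [ValuativeRel F] [TopologicalSpace F] [IsNonarchimedeanLocalField F]
variable {A : Type u} [AddCommGroup A] [TopologicalSpace A] [DiscreteTopology A]
variable (ρ : ContinuousRep (absoluteGaloisGroup F) ℤ A) (C : Submodule ℤ A)
  (hC : ∀ g : absoluteGaloisGroup F, C ≤ C.comap (ρ g))

/-- **`H¹(I_F, A) → H¹(I_F, A/C)` is injective** for a Tate-shaped inertia module: `A` discrete,
`p`-primary and `p`-divisible (`p ≠` residue characteristic, `A[p]` finite), `C` a `Γ_F`-stable
`p`-divisible submodule with `#C[p] ≤ p` on which — as on `A/C` — the inertia group acts trivially,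
while `I_F` does NOT act trivially on `A`. Proof: by the cohomology sequence it suffices that the
connecting map `δ₀ : (A/C)^{I} = A/C → H¹(I, C)` be surjective; its image is `p`-divisible (image of
a divisible group) and nonzero (`A^{I} ≠ A`), inside the `p`-primary `H¹(I, C)` whose `p`-torsion has
`≤ #C[p] ≤ p` elements (`natCard_torsionBy_continuousCohomology_one_absInertia_le`), so it is
everything (`eq_top_of_divisible_of_card_nsmul_le`). For `A = E[p^∞]` at a multiplicative `v ∤ p`,
`C ≅ μ_{p^∞}`: Greenberg–Vatsal p. 14, with Greenberg's Prop. 2 (1989) behind the corank count.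
[cite: GreenbergVatsal2000, §2 pp. 14–15 and Prop. (2.4) p. 22] [cite: Greenberg1989, §2 Prop. 2]
[cite: SerreGaloisCohomology1997, I §2.2] -/
theorem cohomologyMap_mkQHom_one_injective {p : ℕ} [hp : Fact p.Prime]
    (hpF : p.Coprime (ringChar 𝓀[F]))
    (hCtriv : ∀ σ ∈ absInertia F, ∀ c ∈ C, ρ σ c = c)
    (hDtriv : ∀ σ ∈ absInertia F, ∀ a : A, ρ σ a - a ∈ C)
    (hCdiv : ∀ c ∈ C, ∃ c' ∈ C, p • c' = c)
    (hAdiv : ∀ a : A, ∃ b : A, p • b = a)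
    (hAprim : ∀ a : A, ∃ n : ℕ, p ^ n • a = 0)
    [Finite (Submodule.torsionBy ℤ A (p : ℤ))]
    (hCp : Nat.card (Submodule.torsionBy ℤ C (p : ℤ)) ≤ p)
    (hmove : ∃ σ ∈ absInertia F, ∃ a : A, ρ σ a ≠ a) :
    Injective (cohomologyMap
      ((ρ.restrict (subgroupIncl (absInertia F))).mkQHom C (fun g => hC g.1)) 1) := by
  haveI : CompactSpace (absoluteGaloisGroup F) := absoluteGaloisGroup_compactSpace F
  haveI : CompactSpace (absInertia F) :=
    isCompact_iff_compactSpace.mp (isClosed_absInertia_holds F).isCompact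
  set ρI := ρ.restrict (subgroupIncl (absInertia F)) with hρI
  have hCI : ∀ g : absInertia F, C ≤ C.comap (ρI g) := fun g => hC g.1
  have hSES : IsSES (subtypeHom ρI C hCI) (ρI.mkQHom C hCI) := isSES_subtype_mkQ ρI C hCI
  -- the subrepresentation `C`, over `Γ_F` and over `I_F`
  set ρC : ContinuousRep (absoluteGaloisGroup F) ℤ C := ρ.subrepresentation C hC with hρC
  have hrepC : ρC.restrict (subgroupIncl (absInertia F)) = ρI.subrepresentation C hCI := rfl
  -- (a) `H¹(I, C)` is `p`-primary
  have hCprim : ∀ c : C, ∃ n : ℕ, p ^ n • c = 0 := fun c => by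
    obtain ⟨n, hn⟩ := hAprim (c : A)
    exact ⟨n, Subtype.ext (by rw [Submodule.coe_smul_of_tower, Submodule.coe_zero]; exact hn)⟩
  have hYprim : ∀ y : continuousCohomology 1 (ρI.subrepresentation C hCI).toTopRep,
      ∃ N : ℕ, y ∈ Submodule.torsionBy ℤ _ ((p ^ N : ℕ) : ℤ) :=
    exists_prime_pow_smul_oneCocycleClass_eq_zero _ hCprim
  -- (b) `#H¹(I, C)[p] ≤ #C[p] ≤ p`
  haveI hCfin : Finite (Submodule.torsionBy ℤ C (p : ℤ)) := by
    have hinj : Injective (fun c : Submodule.torsionBy ℤ C (p : ℤ) =>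
        (⟨((c : C) : A), by
          have := (Submodule.mem_torsionBy_iff _ _).1 c.2
          rw [Submodule.mem_torsionBy_iff, ← Submodule.coe_smul, this, Submodule.coe_zero]⟩ :
          Submodule.torsionBy ℤ A (p : ℤ))) := by
      intro a b hab
      exact Subtype.ext (Subtype.ext (congrArg (fun x : Submodule.torsionBy ℤ A (p : ℤ) => (x : A)) hab))
    exact Finite.of_injective _ hinj
  have hCdiv' : ∀ c : C, ∃ c' : C, p • c' = c := fun c => by
    obtain ⟨c', hc'C, hc'⟩ := hCdiv c c.2
    exact ⟨⟨c', hc'C⟩, Subtype.ext (by rw [Submodule.coe_smul_of_tower]; exact hc')⟩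
  have hYp : Nat.card (Submodule.torsionBy ℤ
      (continuousCohomology 1 (ρI.subrepresentation C hCI).toTopRep) (p : ℤ)) ≤ p := by
    have h := natCard_torsionBy_continuousCohomology_one_absInertia_le F ρC hpF hCdiv'
    rw [hrepC] at h
    refine h.trans ((Nat.card_le_card_of_injective _ Subtype.val_injective).trans hCp)
  haveI hYpfin : Finite (Submodule.torsionBy ℤ
      (continuousCohomology 1 (ρI.subrepresentation C hCI).toTopRep) (p : ℤ)) := by
    have h := finite_torsionBy_continuousCohomology_one_absInertia F ρC hpF hCdiv'
    rw [hrepC] at h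
    exact h
  -- (c) the image of `δ₀` is everything
  have hD_inv : ∀ d : A ⧸ C, d ∈ (ρI.quotient C hCI).toTopRep.ρ.invariants := by
    intro d σ
    induction d using Submodule.Quotient.induction_on with
    | _ a =>
      change Submodule.Quotient.mk (ρ σ.1 a) = Submodule.Quotient.mk a
      rw [Submodule.Quotient.eq]
      exact hDtriv σ.1 σ.2 a
  let M : AddSubgroup (continuousCohomology 1 (ρI.subrepresentation C hCI).toTopRep) :=
    hSES.δ₀.toAddMonoidHom.range
  have hMtop : M = ⊤ := by
    refine eq_top_of_divisible_of_card_nsmul_le (p := p) (fun y => ?_) (fun s hs => ?_) M ?_ ?_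
    · obtain ⟨N, hN⟩ := hYprim y
      exact ⟨N, by rw [← Nat.cast_smul_eq_nsmul ℤ]; exact (Submodule.mem_torsionBy_iff _ _).1 hN⟩
    · -- `s ⊆ H¹(I, C)[p]`, which has at most `p` elements
      haveI := Fintype.ofFinite (Submodule.torsionBy ℤ
          (continuousCohomology 1 (ρI.subrepresentation C hCI).toTopRep) (p : ℤ))
      have hmem : ∀ y ∈ s, y ∈ Submodule.torsionBy ℤ
          (continuousCohomology 1 (ρI.subrepresentation C hCI).toTopRep) (p : ℤ) := fun y hy => by
        rw [Submodule.mem_torsionBy_iff, Nat.cast_smul_eq_nsmul]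
        exact hs y hy
      have h1 : (s.subtype (· ∈ Submodule.torsionBy ℤ
          (continuousCohomology 1 (ρI.subrepresentation C hCI).toTopRep) (p : ℤ))).card = s.card := by
        rw [Finset.card_subtype, Finset.filter_true_of_mem hmem]
      rw [← h1]
      refine (Finset.card_le_univ _).trans ?_
      rw [← Nat.card_eq_fintype_card]
      exact hYp
    · -- the image of `δ₀` is `p`-divisible (`A`, hence `A/C`, is `p`-divisible)
      rintro _ ⟨d, rfl⟩
      obtain ⟨a, ha⟩ := Submodule.mkQ_surjective C (d : A ⧸ C)
      obtain ⟨b, hb⟩ := hAdiv a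
      refine ⟨hSES.δ₀ ⟨C.mkQ b, hD_inv _⟩, ⟨_, rfl⟩, ?_⟩
      change p • hSES.δ₀ _ = hSES.δ₀ d
      rw [← map_nsmul]
      congr 1
      apply Subtype.ext
      change p • C.mkQ b = (d : A ⧸ C)
      rw [← map_nsmul, hb]
      exact ha
    · -- `δ₀ ≠ 0`: otherwise every class of `A/C` lifts to an `I`-invariant, forcing `A^{I} = A`
      intro hM
      obtain ⟨σ, hσ, a, hne⟩ := hmove
      have h0 : hSES.δ₀ ⟨C.mkQ a, hD_inv _⟩ = 0 := by
        have : hSES.δ₀ ⟨C.mkQ a, hD_inv _⟩ ∈ M := ⟨_, rfl⟩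
        rw [hM] at this
        exact (AddSubgroup.mem_bot).1 this
      obtain ⟨w, hw, hwv⟩ := (hSES.δ₀_eq_zero_iff _).1 h0
      have hwa : w - a ∈ C := by
        rw [← Submodule.Quotient.eq, ← Submodule.mkQ_apply]
        exact hwv
      have hσw : ρ σ w = w := hw ⟨σ, hσ⟩
      apply hne
      calc ρ σ a = ρ σ w - ρ σ (w - a) := by rw [map_sub, sub_sub_cancel]
        _ = w - (w - a) := by rw [hσw, hCtriv σ hσ _ hwa]
        _ = a := sub_sub_cancel w a
  -- (d) conclusion: `H¹(C) → H¹(A)` vanishes, so `H¹(A) → H¹(A/C)` is injective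
  have hzero : ∀ z : continuousCohomology 1 ρI.toTopRep,
      cohomologyMap (ρI.mkQHom C hCI) 1 z = 0 → z = 0 := by
    intro z hz
    obtain ⟨x₁, rfl⟩ := hSES.exists_map_one_eq_of_map_one_eq_zero z hz
    have hx₁ : x₁ ∈ M := by rw [hMtop]; exact AddSubgroup.mem_top _
    obtain ⟨d, rfl⟩ := hx₁
    exact hSES.map_one_δ₀ d
  intro x y hxy
  rw [← sub_eq_zero]
  refine hzero _ ?_
  rw [map_sub, sub_eq_zero]
  exact hxy

end Abstract

end Summit.BirchSwinnertonDyer.Rank1Residual.X2.LocalInertiaTateQuotient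

end
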